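import Summits.HodgeConjecture.HodgeConjecture.Theorems.K2E5QuatAdelicMeasureOneDefs   -- ★ #3k-bis (p855560): `QuatUnitsOnePin`, `exists_quatUnitsOnePin`, `kerModuleEquivUnitsOne`; brings ★ #3j-bis `quatModuleSection`
import Summits.HodgeConjecture.HodgeConjecture.Theorems.K2E5HaarPinProd                -- ★ A9 (p855218): `lintegral_eq_of_pin`; brings ★ `lintegral_fiberLIntegral_quotientMeasure`, `measurable_fiberLIntegral`
import Summits.HodgeConjecture.HodgeConjecture.Theorems.K2E5QuatUnitsUnimodular        -- ★ G7a (p855811): `exists_isHaarMeasure_isMulRightInvariant_quatAdelicUnitsOne`, `ℝ≥0ˣ` locally compact ∕ second countable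
import Summits.HodgeConjecture.HodgeConjecture.Theorems.K2E5QuatUnitsOneTopology       -- ★ (K2E5-p07): `locallyCompactSpace_∕secondCountableTopology_∕t2Space_quatAdelicUnits(One)`
import Literature.NumberTheory.Automorphic.GLnIwasawaIntegration                    -- ★ `isInvInvariant_of_isMulRightInvariant` (a two-sided Haar measure is inversion invariant)
import HarnessLib

/-!
# K2 ∕ E5 «TamagawaUnitary» — (27) `K2E5QuatModuleOneDisintegration`: the module-one disintegration `dx = dx¹ ⊗ dt` of a Haar measure on `(D_h ⊗ 𝔸)^×`

Cell `hodgecm-mathlib` (Track B «K2-LIT»), engine E5, item h413 = `stmt-HodgeConjecture-24833` (`--supports … --as helper`); dealt BY NAME by K2E5-plan (g2)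
(SWEEP #12c (27), 2026-09-04T00:06:45Z) to K2E5-p03 (g2).  THE DISINTEGRATION HYPOTHESIS of sockets G3 `sig_K2E5QuatZetaResidue` (:112) and G0D
`sig_K2E5QuatUnitsOneCovolInvariance` (:158) of `Cruxes/H413/Lines/K2_E5_TamagawaUnitary_Zeta.lean`, VERBATIM:
`∀ f measurable, ∫⁻ x, f x ∂dx = ∫⁻ t : ℝ, ∫⁻ y, f (y · θ(e^t)) ∂dx¹` (`θ = quatModuleSection`, ★ #3j-bis) — DISCHARGED for every two-sided Haar measure `dx`
on `(D_h ⊗ 𝔸)^×` (existence of `dx¹`), with UNIQUENESS of `dx¹` and its SCALING in `dx`, so that `V(h) := covol(D^{(1)}_{h,𝔸} ∕ Γ_h, dx¹)` is a function of `dx`.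

THE MATHEMATICS ([VignerasLNM800, Ch. III §2, proof of Thm. 2.2: «dx^* = dx¹ · dt∕t»]; [WeilBNT1967, Ch. IV §4; Ch. VII §5 Lemma 6]; [DeitmarEchterhoff2014, Thm. 1.5.3]).
* §1 `expUnitsHomeomorph : ℝ ≃ₜ ℝ_{>0}`, `t ↦ e^t` (the section parameter of the sockets, token for token) and `tauExp := (e^·)_* (Lebesgue)`, a Haar measure on the
  commutative group `ℝ_{>0} = ℝ≥0ˣ` («`dt∕t`»): `isHaarMeasure_tauExp`.
* §2 PIN ⇒ DISINTEGRATION (`lintegral_eq_of_quatUnitsOnePin`): if `(kerLift ‖·‖)_* (dx ∕ μ¹) = tauExp` (★ #3k-bis `QuatUnitsOnePin`), then for every Borel `f ≥ 0`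
  `∫ f dx = ∫_ℝ ∫_{D^{(1)}} f(y θ(e^t)) dμ¹(y) dt` — Weil's formula with constant one for `dx ∕ μ¹` (★ A9 `lintegral_eq_of_pin`) applied to `Ψ(s) := ∫ f(θ(s) k) dμ¹(k)`,
  which IS the fibre integral of `f` because `x = θ(‖x‖) · (θ(‖x‖)⁻¹ x)` with the second factor in the kernel (left invariance of `μ¹`) and `θ` is CENTRAL; then the
  change of variables `s = e^t`.  The kernel currency `ker ‖·‖` of the pin and the socket currency `quatAdelicUnitsOne` (equal subgroups, ★ `kerModuleEquivUnitsOne`)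
  are bridged by `Measure.map`.
* §3 EXISTENCE (`exists_moduleOne_disintegration`): for every two-sided Haar `dx` a two-sided Haar `dx¹` on `D^{(1)}_{h,𝔸}` with the socket formula EXISTS — ★ #3k-bis
  `exists_quatUnitsOnePin` (★ A5) at `τ := tauExp`, its unimodularity witness supplied by ★ G7a, then §2.
* §4 UNIQUENESS AND SCALING (`moduleOne_disintegration_unique`, `moduleOne_disintegration_smul`): two Haar measures `dx¹, dx¹′` disintegrating the same `dx` are
  equal (Haar uniqueness `dx¹′ = c • dx¹` on the second countable `D^{(1)}_{h,𝔸}`, and the formula tested on a compact neighbourhood of `1` forces `c = 1`);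
  `(c • dx, c • dx¹)` disintegrates whenever `(dx, dx¹)` does.
Consumers: cert §6 `G0D_of_sigs` (instantiates G3's hypothesis for `C • quatUnitsProductHaar` and for `quatUnitsBeta`), (γ5).

HONEST LABEL: HC_CM is proved only modulo the 7 printed citations (2 remaining named inputs: hLiu418 = stmt-HodgeConjecture-24832,
h413 = stmt-HodgeConjecture-24833) until rung 0 closes; this file is a count-neutral helper of the K2_E5 road and retires nothing by itself.
-/

set_option autoImplicit false
set_option linter.dupNamespace false

noncomputable section

namespace Summit.HodgeConjecture.HodgeConjecture.Cruxes.H413.K2E5QuatModuleOneDisintegration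

open MeasureTheory Measure NumberField IsDedekindDomain Topology
open Literature.MeasureTheory.Group Literature.NumberTheory.Automorphic
open Summit.HodgeConjecture.HodgeConjecture.Cruxes.H413.K2E5QuatAdelicMatrixModel
open Summit.HodgeConjecture.HodgeConjecture.Cruxes.H413.K2E5QuatAdelicNrd
open Summit.HodgeConjecture.HodgeConjecture.Cruxes.H413.K2E5QuatAdelicLattice
open Summit.HodgeConjecture.HodgeConjecture.Cruxes.H413.K2E5QuatAdelicModuleOne
open Summit.HodgeConjecture.HodgeConjecture.Cruxes.H413.K2E5QuatAdelicMeasureOne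
open Summit.HodgeConjecture.HodgeConjecture.Cruxes.H413.K2E5QuatUnitsUnimodular
open Summit.HodgeConjecture.HodgeConjecture.Cruxes.H413.K2E5QuatUnitsOneTopology
open scoped Matrix MatrixGroups ENNReal NNReal

/-! ## §1 The section parameter `t ↦ e^t : ℝ ≃ₜ ℝ_{>0}` and the Haar measure `tauExp = dt∕t` -/

section Exp

/-- **`e^t` as a unit of `ℝ≥0`** — the homeomorphism `ℝ ≃ₜ ℝ_{>0} = ℝ≥0ˣ`, `t ↦ e^t`, whose forward map is TOKEN FOR TOKEN the section parameter
`Units.mk0 (Real.toNNReal (Real.exp t)) _` of sockets G3 ∕ G0D; inverse `s ↦ log s`. [cite: VignerasLNM800, Ch. III §2 (t = module, dt∕t)] -/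
def expUnitsHomeomorph : ℝ ≃ₜ ℝ≥0ˣ where
  toFun t := Units.mk0 (Real.toNNReal (Real.exp t)) (Real.toNNReal_pos.2 (Real.exp_pos t)).ne'
  invFun s := Real.log ((s : ℝ≥0) : ℝ)
  left_inv t := by
    simp only [Units.val_mk0, Real.coe_toNNReal _ (Real.exp_pos t).le, Real.log_exp]
  right_inv s := by
    ext
    have hs : (0 : ℝ) < ((s : ℝ≥0) : ℝ) := NNReal.coe_pos.2 (pos_iff_ne_zero.2 s.ne_zero)
    simp only [Units.val_mk0, Real.exp_log hs, Real.toNNReal_coe]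
  continuous_toFun := by
    refine Units.continuous_iff.2 ⟨?_, ?_⟩
    · exact continuous_real_toNNReal.comp Real.continuous_exp
    · exact (continuous_real_toNNReal.comp Real.continuous_exp).inv₀ fun t => (Real.toNNReal_pos.2 (Real.exp_pos t)).ne'
  continuous_invFun :=
    (Real.continuousOn_log.comp_continuous (NNReal.continuous_coe.comp Units.continuous_val)
      fun s => (NNReal.coe_pos.2 (pos_iff_ne_zero.2 s.ne_zero)).ne')

/-- `expUnitsHomeomorph t = Units.mk0 (Real.toNNReal (Real.exp t)) _` (definitional). [folklore] -/
theorem expUnitsHomeomorph_apply (t : ℝ) :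
    expUnitsHomeomorph t = Units.mk0 (Real.toNNReal (Real.exp t)) (Real.toNNReal_pos.2 (Real.exp_pos t)).ne' := rfl

/-- `(e^t : ℝ≥0) = toNNReal (exp t)` (value of the unit). [folklore] -/
theorem coe_expUnitsHomeomorph (t : ℝ) : ((expUnitsHomeomorph t : ℝ≥0ˣ) : ℝ≥0) = Real.toNNReal (Real.exp t) := rfl

/-- `e^{a + t} = e^a · e^t` in `ℝ≥0ˣ`. [folklore] -/
theorem expUnitsHomeomorph_add (a t : ℝ) : expUnitsHomeomorph (a + t) = expUnitsHomeomorph a * expUnitsHomeomorph t := by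
  ext
  rw [Units.val_mul, coe_expUnitsHomeomorph, coe_expUnitsHomeomorph, coe_expUnitsHomeomorph, Real.exp_add, Real.toNNReal_mul (Real.exp_pos a).le]

/-- Left translation by `s ∈ ℝ_{>0}` is conjugate to translation by `log s` on `ℝ`: `s · e^t = e^{log s + t}`. [folklore] -/
theorem mul_expUnitsHomeomorph (s : ℝ≥0ˣ) (t : ℝ) : s * expUnitsHomeomorph t = expUnitsHomeomorph (expUnitsHomeomorph.symm s + t) := by
  rw [expUnitsHomeomorph_add, Homeomorph.apply_symm_apply]

variable [MeasurableSpace ℝ≥0ˣ]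

/-- **`tauExp := (t ↦ e^t)_* (Lebesgue)`** — the Haar measure «`dt∕t`» of `ℝ_{>0}` transported from Lebesgue measure on `ℝ` along `t ↦ e^t`; the measure on the module
against which the sockets' `∫⁻ t : ℝ, … (θ(e^t)) …` is a change of variables. [cite: VignerasLNM800, Ch. III §2 (dx^* = dx¹ · dt∕t)] [cite: WeilBNT1967, Ch. VII §5 Lemma 6] -/
def tauExp : Measure ℝ≥0ˣ :=
  Measure.map expUnitsHomeomorph volume

/-- Unfolding of `tauExp`. [folklore] -/
theorem tauExp_def : (tauExp : Measure ℝ≥0ˣ) = Measure.map expUnitsHomeomorph volume := rfl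

variable [BorelSpace ℝ≥0ˣ]

/-- Change of variables `s = e^t`: `∫⁻ s, Ψ s ∂tauExp = ∫⁻ t, Ψ (e^t) dt` for Borel `Ψ`. [folklore] -/
theorem lintegral_tauExp {Ψ : ℝ≥0ˣ → ℝ≥0∞} (hΨ : Measurable Ψ) :
    ∫⁻ s, Ψ s ∂tauExp = ∫⁻ t : ℝ, Ψ (Units.mk0 (Real.toNNReal (Real.exp t)) (Real.toNNReal_pos.2 (Real.exp_pos t)).ne') := by
  rw [tauExp_def, lintegral_map hΨ expUnitsHomeomorph.continuous.measurable]
  rfl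

/-- **`tauExp` is a Haar measure on `ℝ_{>0}`**: left invariant (translation by `s` is conjugate to translation by `log s` on `ℝ`, Lebesgue measure is translation
invariant), finite on compacts and positive on opens (transport along a homeomorphism). [cite: WeilBNT1967, Ch. VII §5 Lemma 6] -/
theorem isHaarMeasure_tauExp : (tauExp : Measure ℝ≥0ˣ).IsHaarMeasure := by
  have hE : Measurable (expUnitsHomeomorph : ℝ → ℝ≥0ˣ) := expUnitsHomeomorph.continuous.measurable
  have hleft : (tauExp : Measure ℝ≥0ˣ).IsMulLeftInvariant := by
    refine ⟨fun s => ?_⟩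
    rw [tauExp_def, Measure.map_map (measurable_const_mul s) hE]
    have hcomp : ((fun x : ℝ≥0ˣ => s * x) ∘ (expUnitsHomeomorph : ℝ → ℝ≥0ˣ)) =
        (expUnitsHomeomorph : ℝ → ℝ≥0ˣ) ∘ fun t : ℝ => expUnitsHomeomorph.symm s + t := by
      funext t
      exact mul_expUnitsHomeomorph s t
    rw [hcomp, ← Measure.map_map hE (measurable_const_add _), map_add_left_eq_self]
  have hfin : IsFiniteMeasureOnCompacts (tauExp : Measure ℝ≥0ˣ) := by
    refine ⟨fun K hK => ?_⟩
    rw [tauExp_def, Measure.map_apply hE hK.measurableSet]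
    exact (expUnitsHomeomorph.isCompact_preimage.2 hK).measure_lt_top
  have hpos : (tauExp : Measure ℝ≥0ˣ).IsOpenPosMeasure :=
    expUnitsHomeomorph.continuous.isOpenPosMeasure_map expUnitsHomeomorph.surjective
  exact { toIsFiniteMeasureOnCompacts := hfin, toIsMulLeftInvariant := hleft, toIsOpenPosMeasure := hpos }

/-- `tauExp` is right invariant (`ℝ_{>0}` is commutative). [folklore] -/
theorem isMulRightInvariant_tauExp : (tauExp : Measure ℝ≥0ˣ).IsMulRightInvariant := by
  haveI := isHaarMeasure_tauExp
  refine ⟨fun s => ?_⟩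
  rw [show (fun x : ℝ≥0ˣ => x * s) = fun x => s * x from funext fun x => mul_comm x s]
  exact map_mul_left_eq_self _ s

end Exp

/-! ## §2 Pin ⇒ disintegration -/

section Pin

variable (L : Type) [Field L] [NumberField L] [IsCMField L] (Ha : Matrix (Fin 2) (Fin 2) L)
variable [MeasurableSpace (GL (Fin 2) (AdeleRing (𝓞 L) L))] [BorelSpace (GL (Fin 2) (AdeleRing (𝓞 L) L))]

/-- `kerModuleEquivUnitsOne : ker ‖·‖ ≃* D^{(1)}_{h,𝔸}` as a measurable equivalence (it is a homeomorphism, ★ #3k-bis). [folklore] -/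
def kerModuleMeasurableEquiv : ↥(quatModuleUnits L Ha).ker ≃ᵐ ↥(quatAdelicUnitsOne L Ha) where
  toEquiv := (kerModuleEquivUnitsOne L Ha).toEquiv
  measurable_toFun := (continuous_kerModuleEquivUnitsOne L Ha).measurable
  measurable_invFun := (continuous_kerModuleEquivUnitsOne_symm L Ha).measurable

/-- `kerModuleMeasurableEquiv` is `kerModuleEquivUnitsOne` on elements. [folklore] -/
theorem coe_kerModuleMeasurableEquiv : ⇑(kerModuleMeasurableEquiv L Ha) = ⇑(kerModuleEquivUnitsOne L Ha) := rfl

/-- The transport `(kerModuleEquivUnitsOne)_* μ¹` of a Haar measure on `ker ‖·‖` is a Haar measure on `D^{(1)}_{h,𝔸}`. [folklore] -/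
theorem isHaarMeasure_map_kerModuleEquivUnitsOne (μ1 : Measure ↥(quatModuleUnits L Ha).ker) [μ1.IsHaarMeasure] :
    (Measure.map (kerModuleEquivUnitsOne L Ha) μ1).IsHaarMeasure :=
  (kerModuleEquivUnitsOne L Ha).isHaarMeasure_map μ1 (continuous_kerModuleEquivUnitsOne L Ha) (continuous_kerModuleEquivUnitsOne_symm L Ha)

/-- The transport of a right-invariant measure along `kerModuleEquivUnitsOne` is right invariant. [folklore] -/
theorem isMulRightInvariant_map_kerModuleEquivUnitsOne (μ1 : Measure ↥(quatModuleUnits L Ha).ker) [μ1.IsMulRightInvariant] :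
    (Measure.map (kerModuleEquivUnitsOne L Ha) μ1).IsMulRightInvariant := by
  have he : Measurable (kerModuleEquivUnitsOne L Ha) := (continuous_kerModuleEquivUnitsOne L Ha).measurable
  refine ⟨fun g => ?_⟩
  rw [Measure.map_map (measurable_mul_const g) he]
  have hcomp : ((fun x : ↥(quatAdelicUnitsOne L Ha) => x * g) ∘ ⇑(kerModuleEquivUnitsOne L Ha)) =
      ⇑(kerModuleEquivUnitsOne L Ha) ∘ fun k => k * (kerModuleEquivUnitsOne L Ha).symm g := by
    funext k
    simp only [Function.comp_apply, map_mul, MulEquiv.apply_symm_apply]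
  rw [hcomp, ← Measure.map_map he (measurable_mul_const _), map_mul_right_eq_self]

/-- **Measurability of the section integral** `t ↦ ∫_{D^{(1)}} f(y θ(e^t)) d(dx¹)(y)` for Borel `f ≥ 0` and s-finite `dx¹` (Tonelli; the integrand is jointly Borel on the
second countable `ℝ × D^{(1)}_{h,𝔸}`). [folklore] -/
theorem measurable_lintegral_section (dx1 : Measure ↥(quatAdelicUnitsOne L Ha)) [SFinite dx1]
    {f : ↥(quatAdelicUnits L Ha) → ℝ≥0∞} (hf : Measurable f) :
    Measurable fun t : ℝ => ∫⁻ y, f ((y : ↥(quatAdelicUnits L Ha)) *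
      quatModuleSection L Ha (Units.mk0 (Real.toNNReal (Real.exp t)) (Real.toNNReal_pos.2 (Real.exp_pos t)).ne')) ∂dx1 := by
  haveI := secondCountableTopology_quatAdelicUnits L Ha
  haveI := secondCountableTopology_quatAdelicUnitsOne L Ha
  have hc : Continuous fun p : ℝ × ↥(quatAdelicUnitsOne L Ha) => (p.2 : ↥(quatAdelicUnits L Ha)) * quatModuleSection L Ha (expUnitsHomeomorph p.1) :=
    (continuous_subtype_val.comp continuous_snd).mul ((continuous_quatModuleSection L Ha).comp (expUnitsHomeomorph.continuous.comp continuous_fst))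
  exact (hf.comp hc.measurable).lintegral_prod_right'

/-- **PIN ⇒ DISINTEGRATION.**  If the two-sided Haar measure `dx` on `(D_h ⊗ 𝔸)^×` is pinned along the module to `(μ¹, tauExp)` — `(kerLift ‖·‖)_* (dx ∕ μ¹) = (e^·)_* dt`
(★ #3k-bis `QuatUnitsOnePin`) — then for every Borel `f ≥ 0`, with `dx¹ := (kerModuleEquivUnitsOne)_* μ¹` on `D^{(1)}_{h,𝔸}`:
`∫ f dx = ∫_ℝ ∫_{D^{(1)}} f(y · θ(e^t)) d(dx¹)(y) dt` — the disintegration hypothesis of sockets G3 (:112) ∕ G0D (:158) TOKEN FOR TOKEN.  Weil's formula with constant one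
for `dx ∕ μ¹` (★ A9 `lintegral_eq_of_pin`) at `Ψ(s) := ∫ f(θ(s) k) dμ¹(k)`, which is the fibre integral of `f` since `x = θ(‖x‖) · (θ(‖x‖)⁻¹ x)` with the second factor in
`ker ‖·‖` (left invariance of `μ¹`); centrality of `θ` (★ `quatModuleSection_mul_comm`); change of variables `s = e^t`.
[cite: VignerasLNM800, Ch. III §2 (proof of Thm. 2.2, dx^* = dx¹ · dt∕t)] [cite: WeilBNT1967, Ch. IV §4] [cite: DeitmarEchterhoff2014, Thm. 1.5.3] -/
theorem lintegral_eq_of_quatUnitsOnePin [MeasurableSpace ℝ≥0ˣ] [BorelSpace ℝ≥0ˣ]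
    (dx : Measure ↥(quatAdelicUnits L Ha)) [dx.IsHaarMeasure] [dx.IsMulRightInvariant]
    (μ1 : Measure ↥(quatModuleUnits L Ha).ker) [μ1.IsHaarMeasure] [μ1.IsInvInvariant]
    (hpin : QuatUnitsOnePin L Ha dx μ1 tauExp)
    (f : ↥(quatAdelicUnits L Ha) → ℝ≥0∞) (hf : Measurable f) :
    ∫⁻ x, f x ∂dx = ∫⁻ t : ℝ, ∫⁻ y, f ((y : ↥(quatAdelicUnits L Ha)) *
      quatModuleSection L Ha (Units.mk0 (Real.toNNReal (Real.exp t)) (Real.toNNReal_pos.2 (Real.exp_pos t)).ne')) ∂(Measure.map (kerModuleEquivUnitsOne L Ha) μ1) := by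
  haveI := locallyCompactSpace_quatAdelicUnits L Ha
  haveI := secondCountableTopology_quatAdelicUnits L Ha
  haveI := t2Space_quatAdelicUnits L Ha
  haveI hK : IsClosed (((quatModuleUnits L Ha).ker : Subgroup ↥(quatAdelicUnits L Ha)) : Set ↥(quatAdelicUnits L Ha)) := isClosed_ker_quatModuleUnits L Ha
  letI : MeasurableSpace (↥(quatAdelicUnits L Ha) ⧸ (quatModuleUnits L Ha).ker) := borel _
  haveI : BorelSpace (↥(quatAdelicUnits L Ha) ⧸ (quatModuleUnits L Ha).ker) := ⟨rfl⟩
  -- the pin, unfolded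
  have hpin' : Measure.map (QuotientGroup.kerLift (quatModuleUnits L Ha))
      (quotientMeasure (quatModuleUnits L Ha).ker μ1 (isClosed_ker_quatModuleUnits L Ha) dx) = tauExp := hpin
  -- the test function on the module `Ψ(s) := ∫ f(θ(s) k) dμ¹(k)` = the fibre integral of `f` at `θ(s)`
  have hΨm : Measurable fun s : ℝ≥0ˣ => fiberLIntegral (quatModuleUnits L Ha).ker μ1 f (QuotientGroup.mk (quatModuleSection L Ha s)) :=
    (measurable_fiberLIntegral (quatModuleUnits L Ha).ker μ1 hf).comp
      (QuotientGroup.continuous_mk.comp (continuous_quatModuleSection L Ha)).measurable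
  -- `Ψ(‖x‖)` IS the fibre integral of `f` at `x`: `θ(‖x‖)⁻¹ x ∈ ker ‖·‖`
  have hΨf : ∀ x : ↥(quatAdelicUnits L Ha),
      (fun s : ℝ≥0ˣ => fiberLIntegral (quatModuleUnits L Ha).ker μ1 f (QuotientGroup.mk (quatModuleSection L Ha s))) (quatModuleUnits L Ha x) =
        fiberLIntegral (quatModuleUnits L Ha).ker μ1 f (QuotientGroup.mk x) := by
    intro x
    show fiberLIntegral (quatModuleUnits L Ha).ker μ1 f (QuotientGroup.mk (quatModuleSection L Ha (quatModuleUnits L Ha x))) = _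
    congr 1
    refine QuotientGroup.eq.2 ?_
    rw [MonoidHom.mem_ker, map_mul, map_inv, quatModuleUnits_quatModuleSection, inv_mul_cancel]
  have key := K2E5HaarPinProd.lintegral_eq_of_pin (quatModuleUnits L Ha) (continuous_quatModuleUnits L Ha) μ1 dx tauExp hpin' hΨm hf hΨf
  rw [← key, lintegral_tauExp hΨm]
  refine lintegral_congr fun t => ?_
  simp only [fiberLIntegral_mk]
  rw [show Measure.map (⇑(kerModuleEquivUnitsOne L Ha)) μ1 = Measure.map (⇑(kerModuleMeasurableEquiv L Ha)) μ1 from rfl, lintegral_map_equiv]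
  refine lintegral_congr fun k => ?_
  congr 1
  exact quatModuleSection_mul_comm L Ha _ _

end Pin

/-! ## §3 Existence -/

section Existence

variable (L : Type) [Field L] [NumberField L] [IsCMField L] (Ha : Matrix (Fin 2) (Fin 2) L)
variable [MeasurableSpace (GL (Fin 2) (AdeleRing (𝓞 L) L))] [BorelSpace (GL (Fin 2) (AdeleRing (𝓞 L) L))]

/-- **A MODULE-ONE DISINTEGRATION EXISTS** for every two-sided Haar measure `dx` on `(D_h ⊗ 𝔸)^×` (`h` an anisotropic hermitian plane): there is a two-sided Haar measure `dx¹` on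
`D^{(1)}_{h,𝔸} = quatAdelicUnitsOne L h` with `∫ f dx = ∫_ℝ ∫_{D^{(1)}} f(y · θ(e^t)) d(dx¹)(y) dt` for all Borel `f ≥ 0` — the disintegration hypothesis of sockets G3 ∕ G0D
TOKEN FOR TOKEN.  ★ #3k-bis `exists_quatUnitsOnePin` at `τ := tauExp` (its unimodularity witness on the kernel = ★ G7a transported along `kerModuleEquivUnitsOne⁻¹`), then §2.
[cite: VignerasLNM800, Ch. III §2 (proof of Thm. 2.2)] [cite: WeilBNT1967, Ch. IV §4] [cite: DeitmarEchterhoff2014, Thm. 1.5.3] -/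
theorem exists_moduleOne_disintegration (hHa : (Ha.map (cmConjRingHom L)).transpose = Ha)
    (han : ∀ v : Fin 2 → L, Literature.AlgebraicGeometry.ShimuraVarieties.hermForm (cmConjRingHom L) Ha v v = 0 → v = 0) (hdet : Ha.det ≠ 0)
    (dx : Measure ↥(quatAdelicUnits L Ha)) [dx.IsHaarMeasure] [dx.IsMulRightInvariant] :
    ∃ dx1 : Measure ↥(quatAdelicUnitsOne L Ha), dx1.IsHaarMeasure ∧ dx1.IsMulRightInvariant ∧ dx1.IsInvInvariant ∧
      ∀ f : ↥(quatAdelicUnits L Ha) → ℝ≥0∞, Measurable f →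
        ∫⁻ x, f x ∂dx = ∫⁻ t : ℝ, ∫⁻ y, f ((y : ↥(quatAdelicUnits L Ha)) *
          quatModuleSection L Ha (Units.mk0 (Real.toNNReal (Real.exp t)) (Real.toNNReal_pos.2 (Real.exp_pos t)).ne')) ∂dx1 := by
  haveI := locallyCompactSpace_quatAdelicUnits L Ha
  haveI := secondCountableTopology_quatAdelicUnits L Ha
  haveI := t2Space_quatAdelicUnits L Ha
  haveI := locallyCompactSpace_quatAdelicUnitsOne L Ha
  haveI := secondCountableTopology_quatAdelicUnitsOne L Ha
  letI : MeasurableSpace ℝ≥0ˣ := borel _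
  haveI : BorelSpace ℝ≥0ˣ := ⟨rfl⟩
  haveI : (tauExp : Measure ℝ≥0ˣ).IsHaarMeasure := isHaarMeasure_tauExp
  have he : Measurable ⇑(kerModuleEquivUnitsOne L Ha) := (continuous_kerModuleEquivUnitsOne L Ha).measurable
  have hes : Measurable ⇑(kerModuleEquivUnitsOne L Ha).symm := (continuous_kerModuleEquivUnitsOne_symm L Ha).measurable
  -- the unimodularity witness on `ker ‖·‖`: ★ G7a's two-sided Haar measure on `D^{(1)}_{h,𝔸}`, transported along `kerModuleEquivUnitsOne⁻¹`
  obtain ⟨ρ, hρ, hρr⟩ := exists_isHaarMeasure_isMulRightInvariant_quatAdelicUnitsOne L Ha hHa han hdet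
  haveI : ρ.IsInvInvariant := isInvInvariant_of_isMulRightInvariant ρ
  have hunimod : ∃ (ρ₀ : Measure ↥(quatModuleUnits L Ha).ker) (_ : ρ₀.IsHaarMeasure) (_ : ρ₀.IsInvInvariant), ρ₀.IsMulRightInvariant := by
    refine ⟨Measure.map (kerModuleEquivUnitsOne L Ha).symm ρ,
      (kerModuleEquivUnitsOne L Ha).symm.isHaarMeasure_map ρ (continuous_kerModuleEquivUnitsOne_symm L Ha) (continuous_kerModuleEquivUnitsOne L Ha),
      isInvInvariant_map_mulEquiv _ hes ρ, ⟨fun g => ?_⟩⟩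
    rw [Measure.map_map (measurable_mul_const g) hes]
    have hcomp : ((fun x : ↥(quatModuleUnits L Ha).ker => x * g) ∘ ⇑(kerModuleEquivUnitsOne L Ha).symm) =
        ⇑(kerModuleEquivUnitsOne L Ha).symm ∘ fun y => y * kerModuleEquivUnitsOne L Ha g := by
      funext y
      simp only [Function.comp_apply, map_mul, MulEquiv.symm_apply_apply]
    rw [hcomp, ← Measure.map_map hes (measurable_mul_const _), map_mul_right_eq_self]
  obtain ⟨μ1, hμ1, hμ1i, hμ1r, hpin⟩ := exists_quatUnitsOnePin L Ha dx tauExp hunimod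
  exact ⟨Measure.map (kerModuleEquivUnitsOne L Ha) μ1, isHaarMeasure_map_kerModuleEquivUnitsOne L Ha μ1,
    isMulRightInvariant_map_kerModuleEquivUnitsOne L Ha μ1, isInvInvariant_map_mulEquiv _ he μ1,
    lintegral_eq_of_quatUnitsOnePin L Ha dx μ1 hpin⟩

end Existence

/-! ## §4 Uniqueness and scaling -/

section Unique

variable (L : Type) [Field L] [NumberField L] [IsCMField L] (Ha : Matrix (Fin 2) (Fin 2) L)
variable [MeasurableSpace (GL (Fin 2) (AdeleRing (𝓞 L) L))] [BorelSpace (GL (Fin 2) (AdeleRing (𝓞 L) L))]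

/-- **UNIQUENESS OF THE MODULE-ONE MEASURE**: two Haar measures `dx¹, dx¹′` on `D^{(1)}_{h,𝔸}` disintegrating the SAME measure `dx` (finite and positive on some compact set,
e.g. any Haar measure) along the section are EQUAL — Haar uniqueness `dx¹′ = c • dx¹` on the second countable `D^{(1)}_{h,𝔸}` (Mathlib `isMulLeftInvariant_eq_smul`), and the
two formulas tested on `f = 𝟙_K` give `dx(K) = c · dx(K)` with `0 < dx(K) < ∞`.  Hence `V(h) := covol(D^{(1)}_{h,𝔸} ∕ Γ_h, dx¹)` is a function of `dx` alone.
[cite: VignerasLNM800, Ch. III §2] [cite: WeilBNT1967, Ch. IV §4] -/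
theorem moduleOne_disintegration_unique (dx : Measure ↥(quatAdelicUnits L Ha)) [dx.IsHaarMeasure]
    (dx1 dx1' : Measure ↥(quatAdelicUnitsOne L Ha)) [dx1.IsHaarMeasure] [dx1'.IsHaarMeasure]
    (h : ∀ f : ↥(quatAdelicUnits L Ha) → ℝ≥0∞, Measurable f →
        ∫⁻ x, f x ∂dx = ∫⁻ t : ℝ, ∫⁻ y, f ((y : ↥(quatAdelicUnits L Ha)) *
          quatModuleSection L Ha (Units.mk0 (Real.toNNReal (Real.exp t)) (Real.toNNReal_pos.2 (Real.exp_pos t)).ne')) ∂dx1)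
    (h' : ∀ f : ↥(quatAdelicUnits L Ha) → ℝ≥0∞, Measurable f →
        ∫⁻ x, f x ∂dx = ∫⁻ t : ℝ, ∫⁻ y, f ((y : ↥(quatAdelicUnits L Ha)) *
          quatModuleSection L Ha (Units.mk0 (Real.toNNReal (Real.exp t)) (Real.toNNReal_pos.2 (Real.exp_pos t)).ne')) ∂dx1') :
    dx1' = dx1 := by
  haveI := locallyCompactSpace_quatAdelicUnits L Ha
  haveI := t2Space_quatAdelicUnits L Ha
  haveI := locallyCompactSpace_quatAdelicUnitsOne L Ha
  haveI := secondCountableTopology_quatAdelicUnitsOne L Ha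
  -- Haar uniqueness on the second countable `D^{(1)}_{h,𝔸}`
  let c : ℝ≥0∞ := haarScalarFactor dx1' dx1
  have hc : dx1' = c • dx1 := isMulLeftInvariant_eq_smul dx1' dx1
  -- test both formulas on `𝟙_K`, `K` a compact set with non-empty interior
  have K : TopologicalSpace.PositiveCompacts ↥(quatAdelicUnits L Ha) := Classical.arbitrary _
  have hKm : MeasurableSet (K : Set ↥(quatAdelicUnits L Ha)) := K.isCompact.measurableSet
  have hfm : Measurable ((K : Set ↥(quatAdelicUnits L Ha)).indicator (1 : ↥(quatAdelicUnits L Ha) → ℝ≥0∞)) := measurable_one.indicator hKm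
  have h1 := h _ hfm
  have h2 := h' _ hfm
  rw [lintegral_indicator_one hKm] at h1 h2
  rw [hc] at h2
  simp only [lintegral_smul_measure, smul_eq_mul] at h2
  rw [lintegral_const_mul c (measurable_lintegral_section L Ha dx1 hfm), ← h1] at h2
  -- `dx K = c · dx K` with `0 < dx K < ∞`
  have hK0 : dx (K : Set ↥(quatAdelicUnits L Ha)) ≠ 0 := ((isOpen_interior.measure_pos dx K.interior_nonempty).trans_le (measure_mono interior_subset)).ne'
  have hKtop : dx (K : Set ↥(quatAdelicUnits L Ha)) ≠ ∞ := K.isCompact.measure_lt_top.ne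
  have hc1 : c = 1 := ((ENNReal.mul_left_inj hK0 hKtop).1 (h2.symm.trans (one_mul _).symm))
  rw [hc, hc1, one_smul]

/-- **SCALING**: if `(dx, dx¹)` disintegrates then so does `(c • dx, c • dx¹)` for every `c ∈ [0, ∞]` (cert §6 STEP 1: `C • quatUnitsProductHaar`). [folklore] -/
theorem moduleOne_disintegration_smul (c : ℝ≥0∞) (dx : Measure ↥(quatAdelicUnits L Ha)) (dx1 : Measure ↥(quatAdelicUnitsOne L Ha)) [SFinite dx1]
    (h : ∀ f : ↥(quatAdelicUnits L Ha) → ℝ≥0∞, Measurable f →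
        ∫⁻ x, f x ∂dx = ∫⁻ t : ℝ, ∫⁻ y, f ((y : ↥(quatAdelicUnits L Ha)) *
          quatModuleSection L Ha (Units.mk0 (Real.toNNReal (Real.exp t)) (Real.toNNReal_pos.2 (Real.exp_pos t)).ne')) ∂dx1)
    (f : ↥(quatAdelicUnits L Ha) → ℝ≥0∞) (hf : Measurable f) :
    ∫⁻ x, f x ∂(c • dx) = ∫⁻ t : ℝ, ∫⁻ y, f ((y : ↥(quatAdelicUnits L Ha)) *
      quatModuleSection L Ha (Units.mk0 (Real.toNNReal (Real.exp t)) (Real.toNNReal_pos.2 (Real.exp_pos t)).ne')) ∂(c • dx1) := by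
  rw [lintegral_smul_measure, h f hf, smul_eq_mul, ← lintegral_const_mul c (measurable_lintegral_section L Ha dx1 hf)]
  refine lintegral_congr fun t => ?_
  rw [lintegral_smul_measure, smul_eq_mul]

/-- **UNIQUENESS UP TO THE SCALING**: if `dx¹` disintegrates `dx` and `dx¹′` disintegrates `c • dx` (`c ∈ (0, ∞)`, both Haar), then `dx¹′ = c • dx¹`. [folklore] -/
theorem moduleOne_disintegration_eq_smul {c : ℝ≥0∞} (hc0 : c ≠ 0) (hc : c ≠ ∞) (dx : Measure ↥(quatAdelicUnits L Ha)) [dx.IsHaarMeasure]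
    (dx1 dx1' : Measure ↥(quatAdelicUnitsOne L Ha)) [dx1.IsHaarMeasure] [dx1'.IsHaarMeasure]
    (h : ∀ f : ↥(quatAdelicUnits L Ha) → ℝ≥0∞, Measurable f →
        ∫⁻ x, f x ∂dx = ∫⁻ t : ℝ, ∫⁻ y, f ((y : ↥(quatAdelicUnits L Ha)) *
          quatModuleSection L Ha (Units.mk0 (Real.toNNReal (Real.exp t)) (Real.toNNReal_pos.2 (Real.exp_pos t)).ne')) ∂dx1)
    (h' : ∀ f : ↥(quatAdelicUnits L Ha) → ℝ≥0∞, Measurable f →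
        ∫⁻ x, f x ∂(c • dx) = ∫⁻ t : ℝ, ∫⁻ y, f ((y : ↥(quatAdelicUnits L Ha)) *
          quatModuleSection L Ha (Units.mk0 (Real.toNNReal (Real.exp t)) (Real.toNNReal_pos.2 (Real.exp_pos t)).ne')) ∂dx1') :
    dx1' = c • dx1 := by
  haveI := locallyCompactSpace_quatAdelicUnitsOne L Ha
  haveI := secondCountableTopology_quatAdelicUnitsOne L Ha
  haveI : (c • dx).IsHaarMeasure := IsHaarMeasure.smul dx hc0 hc
  haveI : (c • dx1).IsHaarMeasure := IsHaarMeasure.smul dx1 hc0 hc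
  exact moduleOne_disintegration_unique L Ha (c • dx) (c • dx1) dx1' (moduleOne_disintegration_smul L Ha c dx dx1 h) h'

end Unique

end Summit.HodgeConjecture.HodgeConjecture.Cruxes.H413.K2E5QuatModuleOneDisintegration

end
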